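import Mathlib

/-!
# Tower graft line — THE TWO-SIDED THREE-LETTER LAW (Gram–Cauchy certificate): for `F(X) = X^d A + X^{d+e} J + X^{d+3e} B`
# with `A, B ⪰ 0` and `J` ANY real symmetric matrix, the positive-type positive roots of `det F` number at most `rank B ≤ m`;
# hence `Z₊ ≤ 2m` for simple crossings — a SUB-DESCARTES law for a two-sided word, uniform in `m`

Crux `stmt-ValiantsHypothesis-19561` (`Theses.KPlusLogSqLaw.WeakLifting`), line (B) `Cruxes/WeakLifting/Lines/tower_graft.lean`,
the two-sided word instrument (S5 memo §10: `X^e J + Σ X^{dₖ} Pₖ`, `Pₖ ⪰ 0` on both sides of the pivot).  Cell `pub-symmetroid`,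
seat val-sym-lift-p3 g20, `--supports 19561`; NO stub is claimed.

THE THEOREM.  Three letters, pivot in the middle, PSD letters on both sides, exponents `(d, d+e, d+3e)` (`e ≥ 1`; e.g. `(0,1,3)`,
`(0,2,6)`, `(5,6,8)`):
* `TwoSidedThree.card_posType_le_rank` (core) / `card_posType_roots_le` (census currency): any family of DISTINCT positive roots
  `τᵢ` of `det F` carrying kernel vectors `uᵢ` (`F(τᵢ)uᵢ = 0`) of POSITIVE TYPE — the Rayleigh trinomial
  `P_u(X) = ⟨u,Au⟩X^d + ⟨u,Ju⟩X^{d+e} + ⟨u,Bu⟩X^{d+3e}` is strictly INCREASING at its root `τᵢ` (the inertia kit's positive type,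
  `…InertiaIndexFormula`; dictionary `rayleigh_deriv_eq`: `τ·P_u′(τ) = e·τ^d·(2τ^{3e}⟨u,Bu⟩ − ⟨u,Au⟩)`) — has at most `rank B ≤ m`
  members.  No tower / steepness / genericity hypothesis; `J` arbitrary.
* `TwoSidedThree.card_posRoots_le_two_mul` / `card_posRoots_finset_le_two_mul` (THE `2m` LAW): if moreover `A ≻ 0`, `B ≻ 0` and
  every positive root of `det F` is a SIMPLE CROSSING (one-dimensional kernel of definite type — by
  `Multiplicity.rootMultiplicity_det_pencil_eq_one` exactly the simple roots), then the positive roots counted with multiplicity,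
  hence the distinct ones, number AT MOST `2m`: by the tree's GLOBAL INDEX FORMULA (`Inertia.global_index_formula`, mdr-p2) with
  `ν(A) = ν(B) = 0` one has `N⁺ = N⁻` and `Z₊ = N⁺ + N⁻ = 2N⁺ ≤ 2·rank B`.
WHY IT IS NOT DESCARTES.  For the two-sided word `(+)[J](+)` at `m = 3` the coefficient sequence of `det F` (lex runs with theory
signs, the cell's `towercaps` count) allows `8` sign variations and the count grows quadratically in `m`; the located maximum of the
cell's zero-forcing instrument on `(0,1,3)`, `(0,1,4)`, `(0,1,5)`, `(0,2,5)`, `(0,3,4)`, `(0,1,10)`, `(0,4,5)` at `m = 3` is `6 = 2m`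
(this seat, hub, exact re-verification), with the three positive-type and three negative-type roots predicted here.  It is the
first upper bound in this line charged neither to monomials nor to letter counts but to the RANK of a letter, and it is uniform in `m`.
MECHANISM (new to the line; all `m`, pure linear algebra).  At kernel pairs `(τᵢ,uᵢ)` put `sᵢ = τᵢ^e` and form the Gram matrices
`𝔄 = [⟨uᵢ,Auₖ⟩]`, `𝔅 = [⟨uᵢ,Buₖ⟩]`.  Polarising the kernel relations at `τᵢ` and at `τₖ` and eliminating the `J`-Gram entry gives,
for `i ≠ k`, the GRAM–CAUCHY IDENTITY `⟨uᵢ,Auₖ⟩ = sᵢsₖ(sᵢ+sₖ)·⟨uᵢ,Buₖ⟩` (`gramA_eq`; the factor is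
`(sᵢ³sₖ − sᵢsₖ³)/(sᵢ − sₖ)`, whose reciprocal `1/(sᵢsₖ(sᵢ+sₖ))` is a two-sided diagonal scaling of the Cauchy kernel).  Hence
`𝔅 = D⁻¹(𝔄 ⊙ C)D⁻¹ + Δ` with `C = [1/(sᵢ+sₖ)]` the CAUCHY MATRIX, `D = diag(s)`, and `Δ = diag(⟨uᵢ,Buᵢ⟩ − ⟨uᵢ,Auᵢ⟩/(2sᵢ³))`,
which is `≻ 0` exactly on positive-type roots.  `C ⪰ 0` by LYAPUNOV POSITIVITY (`posSemidef_of_lyapunov`: `diag(s)C + C diag(s) =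
𝟙𝟙ᵀ ⪰ 0` forces `C ⪰ 0`, tested on an eigenvector), `𝔄 ⊙ C ⪰ 0` by Schur's product theorem (Mathlib `PosSemidef.hadamard`), so
`𝔅 ≻ 0` on the positive-type family: `#family = rank 𝔅 ≤ rank B`.  For general exponents `(d, d+e, d+b)` the same elimination produces
the Loewner matrix of the power `s^{(b−e)/e}` (resp. `s^{e/(b−e)}` on the `A`-side); it is positive semidefinite exactly when that power
is operator monotone (Loewner), e.g. a Schur product of Cauchy kernels for `b − e = 2^k·e` — NOT typed here (paper remark); the ratio
`3` of this file is the first non-quadratic case (`b = 2e` is the degree-`2m` quadratic pencil).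
HONEST FRAMING.  A structural law for THREE letters; the line's column of record (`2 · =6 · ≥10 · ≥14` at FOUR letters) is untouched,
and nothing here bears on S4/S4b/S4d/S4f/S5, `TowerB`, `WeakLifting` in its window, Conjecture B / `KPlusLogSqLaw`, `MatrixDescartes`
(18050) or `VP ≠ VNP`.  Def-free.  PART A (this file, Mathlib only): §1 Lyapunov positivity + Cauchy kernel, §2 the Gram identities, §3 the core bound
`card_posType_le_rank`.  PART B (`…TwoSidedThreeLettersLaw.lean`): census currency and the `2m` law via the inertia kit.

[folklore] Cauchy matrices / Lyapunov equation / Schur product theorem; sign characteristic of hermitian matrix polynomials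
[GohbergLancasterRodman2005, §12.4–12.5] via the tree's inertia kit.
-/

set_option linter.dupNamespace false
set_option autoImplicit false

namespace Summit.ValiantsHypothesis.ValiantsHypothesis.Theorems.KPlusLogSqLaw.TowerGraft

open Matrix
open scoped BigOperators

namespace TwoSidedThree

/-! ## §1 Lyapunov positivity and the Cauchy kernel -/

section Lyapunov

variable {I : Type} [Fintype I] [DecidableEq I]

/-- for a real symmetric `X`: `x ⬝ᵥ (X *ᵥ y) = (X *ᵥ x) ⬝ᵥ y`. [folklore] -/
theorem dotProduct_mulVec_symm {n : Type} [Fintype n] {S : Matrix n n ℝ} (hS : S.IsSymm) (x y : n → ℝ) :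
    x ⬝ᵥ (S *ᵥ y) = (S *ᵥ x) ⬝ᵥ y := by
  rw [Matrix.dotProduct_mulVec, ← Matrix.mulVec_transpose, hS]

/-- **Lyapunov positivity.**  If `s > 0`, `X` is real symmetric and `diag(s)·X + X·diag(s)` is positive semidefinite, then
`X` is positive semidefinite (test on an eigenvector: `0 ≤ 2λ·∑ sᵢvᵢ²`). [folklore] -/
theorem posSemidef_of_lyapunov (s : I → ℝ) (hs : ∀ i, 0 < s i) {X : Matrix I I ℝ} (hX : X.IsHermitian)
    (h : (Matrix.diagonal s * X + X * Matrix.diagonal s).PosSemidef) : X.PosSemidef := by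
  rw [hX.posSemidef_iff_eigenvalues_nonneg]
  intro j
  change (0 : ℝ) ≤ hX.eigenvalues j
  set v : I → ℝ := ⇑(hX.eigenvectorBasis j) with hvdef
  have hXv : X *ᵥ v = hX.eigenvalues j • v := hX.mulVec_eigenvectorBasis j
  have hXs : X.IsSymm := by
    have h1 := hX
    unfold Matrix.IsHermitian at h1
    rw [Matrix.conjTranspose_eq_transpose_of_trivial] at h1
    exact h1
  -- the quadratic form of the Lyapunov image at `v`
  have hq : 0 ≤ star v ⬝ᵥ ((Matrix.diagonal s * X + X * Matrix.diagonal s) *ᵥ v) :=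
    (Matrix.posSemidef_iff_dotProduct_mulVec.mp h).2 v
  have hD : v ⬝ᵥ (Matrix.diagonal s *ᵥ v) = ∑ i, s i * v i ^ 2 := by
    simp only [dotProduct, Matrix.mulVec_diagonal]
    exact Finset.sum_congr rfl fun i _ => by ring
  have hcalc : star v ⬝ᵥ ((Matrix.diagonal s * X + X * Matrix.diagonal s) *ᵥ v)
      = 2 * hX.eigenvalues j * ∑ i, s i * v i ^ 2 := by
    rw [star_trivial, Matrix.add_mulVec, ← Matrix.mulVec_mulVec, ← Matrix.mulVec_mulVec, hXv,
      Matrix.mulVec_smul, dotProduct_add, dotProduct_smul, dotProduct_mulVec_symm hXs, hXv, smul_dotProduct, hD,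
      smul_eq_mul]
    ring
  -- `∑ sᵢ vᵢ² > 0` since `v` is a unit vector
  have hnorm : ∑ i, v i ^ 2 = 1 := by
    have h1 := hX.eigenvectorBasis.orthonormal.1 j
    rw [EuclideanSpace.norm_eq, Real.sqrt_eq_one] at h1
    rw [← h1]
    exact Finset.sum_congr rfl fun i _ => by rw [Real.norm_eq_abs, sq_abs]
  obtain ⟨i₀, _, hi₀⟩ : ∃ i ∈ Finset.univ, v i ^ 2 ≠ 0 := by
    by_contra hcon
    push Not at hcon
    have : ∑ i, v i ^ 2 = 0 := Finset.sum_eq_zero hcon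
    rw [hnorm] at this
    exact one_ne_zero this
  have hpos : 0 < ∑ i, s i * v i ^ 2 := by
    apply Finset.sum_pos'
    · intro i _; exact mul_nonneg (hs i).le (sq_nonneg _)
    · exact ⟨i₀, Finset.mem_univ _, mul_pos (hs i₀) (lt_of_le_of_ne (sq_nonneg _) (Ne.symm hi₀))⟩
  rw [hcalc] at hq
  by_contra hlt
  push Not at hlt
  have := mul_neg_of_neg_of_pos hlt hpos
  linarith

/-- the CAUCHY MATRIX `[1/(sᵢ + sₖ)]` of positive reals is positive semidefinite (its Lyapunov image is the all-ones
matrix). [folklore] -/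
theorem posSemidef_cauchy (s : I → ℝ) (hs : ∀ i, 0 < s i) :
    (Matrix.of fun i k : I => 1 / (s i + s k)).PosSemidef := by
  have hsym : (Matrix.of fun i k : I => 1 / (s i + s k)).IsHermitian := by
    rw [Matrix.IsHermitian, Matrix.conjTranspose_eq_transpose_of_trivial]
    ext i k
    simp only [Matrix.transpose_apply, Matrix.of_apply, add_comm]
  refine posSemidef_of_lyapunov s hs hsym ?_
  have hone : Matrix.diagonal s * (Matrix.of fun i k : I => 1 / (s i + s k))
      + (Matrix.of fun i k : I => 1 / (s i + s k)) * Matrix.diagonal s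
      = Matrix.vecMulVec (fun _ : I => (1 : ℝ)) (fun _ : I => (1 : ℝ)) := by
    ext i k
    simp only [Matrix.add_apply, Matrix.diagonal_mul, Matrix.mul_diagonal, Matrix.of_apply, Matrix.vecMulVec_apply]
    have : s i + s k ≠ 0 := ne_of_gt (add_pos (hs i) (hs k))
    field_simp
  rw [hone]
  have h := Matrix.posSemidef_vecMulVec_self_star (R := ℝ) (fun _ : I => (1 : ℝ))
  rwa [star_trivial] at h

end Lyapunov

/-! ## §2 The kernel Gram identities of the three-letter pencil -/

section Gram

variable {m : ℕ} {I : Type} [Fintype I] [DecidableEq I]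

/-! (notation of the docstrings: the GRAM MATRIX of the family `u` in the form `S` is `Matrix.of fun i k => uᵢ ⬝ᵥ S uₖ`;
it is kept inline, this file declares no definition.) -/

omit [Fintype I] [DecidableEq I] in
/-- the Gram matrix is `Uᵀ S U` for the column matrix `U` of the family. [folklore] -/
theorem gram_eq_mul (S : Matrix (Fin m) (Fin m) ℝ) (u : I → Fin m → ℝ) :
    (Matrix.of fun i' k' => u i' ⬝ᵥ (S *ᵥ u k')) = (Matrix.of fun r i => u i r)ᵀ * S * Matrix.of fun r i => u i r := by
  ext i k
  simp only [Matrix.of_apply, Matrix.mul_apply, Matrix.transpose_apply, dotProduct, Matrix.mulVec,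
    Finset.sum_mul, Finset.mul_sum, mul_assoc]
  rw [Finset.sum_comm]

omit [DecidableEq I] in
/-- the Gram matrix of a PSD form is PSD. [folklore] -/
theorem posSemidef_gram {S : Matrix (Fin m) (Fin m) ℝ} (hS : S.PosSemidef) (u : I → Fin m → ℝ) :
    ((Matrix.of fun i' k' => u i' ⬝ᵥ (S *ᵥ u k'))).PosSemidef := by
  rw [gram_eq_mul]
  have h := hS.conjTranspose_mul_mul_same (Matrix.of fun r i => u i r)
  rwa [Matrix.conjTranspose_eq_transpose_of_trivial] at h

omit [DecidableEq I] in
/-- the rank of a Gram matrix is at most the rank of the form. [folklore] -/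
theorem rank_gram_le (S : Matrix (Fin m) (Fin m) ℝ) (u : I → Fin m → ℝ) : ((Matrix.of fun i' k' => u i' ⬝ᵥ (S *ᵥ u k'))).rank ≤ S.rank := by
  rw [gram_eq_mul]
  exact (Matrix.rank_mul_le_left _ _).trans (Matrix.rank_mul_le_right _ _)

omit [Fintype I] [DecidableEq I] in
/-- the Gram matrix of a symmetric form is symmetric. [folklore] -/
theorem gram_symm {S : Matrix (Fin m) (Fin m) ℝ} (hS : S.IsSymm) (u : I → Fin m → ℝ) (i k : I) :
    (Matrix.of fun i' k' => u i' ⬝ᵥ (S *ᵥ u k')) i k = (Matrix.of fun i' k' => u i' ⬝ᵥ (S *ᵥ u k')) k i := by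
  simp only [Matrix.of_apply]
  rw [dotProduct_mulVec_symm hS, dotProduct_comm]

variable (A J B : Matrix (Fin m) (Fin m) ℝ) (e : ℕ) (τ : I → ℝ) (u : I → Fin m → ℝ)

omit [Fintype I] [DecidableEq I] in
/-- **kernel relation, polarised**: if `(A + τᵢ^e J + τᵢ^{3e} B) uᵢ = 0` then for every `k`
`⟨uᵢ,Auₖ⟩ + τᵢ^e ⟨uᵢ,Juₖ⟩ + τᵢ^{3e} ⟨uᵢ,Buₖ⟩ = 0`. [folklore] -/
theorem gram_rel (hA : A.IsSymm) (hJ : J.IsSymm) (hB : B.IsSymm)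
    (hker : ∀ i, (A + τ i ^ e • J + (τ i ^ e) ^ 3 • B) *ᵥ u i = 0) (i k : I) :
    (Matrix.of fun i' k' => u i' ⬝ᵥ (A *ᵥ u k')) i k + τ i ^ e * (Matrix.of fun i' k' => u i' ⬝ᵥ (J *ᵥ u k')) i k + (τ i ^ e) ^ 3 * (Matrix.of fun i' k' => u i' ⬝ᵥ (B *ᵥ u k')) i k = 0 := by
  have h := congrArg (fun w => u k ⬝ᵥ w) (hker i)
  simp only [dotProduct_zero, Matrix.add_mulVec, Matrix.smul_mulVec, dotProduct_add, dotProduct_smul,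
    smul_eq_mul] at h
  rw [gram_symm hA u i k, gram_symm hJ u i k, gram_symm hB u i k]
  simp only [Matrix.of_apply]
  linarith

omit [Fintype I] [DecidableEq I] in
/-- **the Gram–Cauchy identity**: for two DISTINCT kernel scales `sᵢ = τᵢ^e ≠ sₖ = τₖ^e`,
`⟨uᵢ,Auₖ⟩ = sᵢ sₖ (sᵢ + sₖ) · ⟨uᵢ,Buₖ⟩`. [folklore] -/
theorem gramA_eq (hA : A.IsSymm) (hJ : J.IsSymm) (hB : B.IsSymm)
    (hker : ∀ i, (A + τ i ^ e • J + (τ i ^ e) ^ 3 • B) *ᵥ u i = 0) {i k : I} (hik : τ i ^ e ≠ τ k ^ e) :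
    (Matrix.of fun i' k' => u i' ⬝ᵥ (A *ᵥ u k')) i k = τ i ^ e * τ k ^ e * (τ i ^ e + τ k ^ e) * (Matrix.of fun i' k' => u i' ⬝ᵥ (B *ᵥ u k')) i k := by
  have h1 := gram_rel A J B e τ u hA hJ hB hker i k
  have h2 := gram_rel A J B e τ u hA hJ hB hker k i
  rw [gram_symm hA u k i, gram_symm hJ u k i, gram_symm hB u k i] at h2
  set si := τ i ^ e
  set sk := τ k ^ e
  have hne : si - sk ≠ 0 := sub_ne_zero.mpr hik
  -- eliminate the `J`-Gram entry
  have hJeq : (Matrix.of fun i' k' => u i' ⬝ᵥ (J *ᵥ u k')) i k = -(si ^ 2 + si * sk + sk ^ 2) * (Matrix.of fun i' k' => u i' ⬝ᵥ (B *ᵥ u k')) i k := by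
    have h3 : (si - sk) * (Matrix.of fun i' k' => u i' ⬝ᵥ (J *ᵥ u k')) i k = -(si - sk) * ((si ^ 2 + si * sk + sk ^ 2) * (Matrix.of fun i' k' => u i' ⬝ᵥ (B *ᵥ u k')) i k) := by
      nlinarith [h1, h2]
    have h4 : (si - sk) * ((Matrix.of fun i' k' => u i' ⬝ᵥ (J *ᵥ u k')) i k + (si ^ 2 + si * sk + sk ^ 2) * (Matrix.of fun i' k' => u i' ⬝ᵥ (B *ᵥ u k')) i k) = 0 := by linarith
    rcases mul_eq_zero.mp h4 with h5 | h5
    · exact absurd h5 hne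
    · linarith
  rw [hJeq] at h1
  linarith

end Gram

/-! ## §3 The positive-type bound -/

section Bound

variable {m : ℕ} {I : Type} [Fintype I] [DecidableEq I]

/-- **THE TWO-SIDED THREE-LETTER LAW (positive type, supports `(d, d+e, d+3e)`; core form).**
Let `A, B ⪰ 0` and `J` be real symmetric `m × m` matrices, `e ≥ 1`, and let `(τᵢ, uᵢ)_{i ∈ I}` be pairs of DISTINCT positive scales
and kernel vectors of the reduced pencil, `(A + τᵢ^e J + τᵢ^{3e} B) uᵢ = 0`, each of POSITIVE TYPE in the sense
`⟨uᵢ,Auᵢ⟩ < 2τᵢ^{3e}⟨uᵢ,Buᵢ⟩` (⟺ the Rayleigh trinomial `⟨uᵢ,Auᵢ⟩ + ⟨uᵢ,Juᵢ⟩t^e + ⟨uᵢ,Buᵢ⟩t^{3e}` is strictly INCREASING at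
its root `τᵢ`, `type_iff_rayleigh_deriv_pos`).  Then `#I ≤ rank B (≤ m)`.
MECHANISM (Gram–Cauchy certificate): with `sᵢ = τᵢ^e`, the kernel relations give `⟨uᵢ,Auₖ⟩ = sᵢsₖ(sᵢ+sₖ)⟨uᵢ,Buₖ⟩` for `i ≠ k`
(`gramA_eq`), so the `B`-Gram matrix is `D⁻¹(Gram_A ⊙ Cauchy(s))D⁻¹ + Δ` with `Δ = diag(⟨uᵢ,Buᵢ⟩ − ⟨uᵢ,Auᵢ⟩/(2sᵢ³)) ≻ 0` exactly
on positive-type roots; Cauchy ⪰ 0 (`posSemidef_cauchy`) and Schur's product theorem make the first summand ⪰ 0, hence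
`Gram_B ≻ 0` of full rank `#I ≤ rank B`. [folklore] -/
theorem card_posType_le_rank (A J B : Matrix (Fin m) (Fin m) ℝ) (hA : A.PosSemidef) (hJ : J.IsSymm) (hB : B.PosSemidef)
    (e : ℕ) (τ : I → ℝ) (hτ : ∀ i, 0 < τ i) (hinj : Function.Injective τ) (he : 0 < e)
    (u : I → Fin m → ℝ) (hker : ∀ i, (A + τ i ^ e • J + (τ i ^ e) ^ 3 • B) *ᵥ u i = 0)
    (htype : ∀ i, u i ⬝ᵥ (A *ᵥ u i) < 2 * (τ i ^ e) ^ 3 * (u i ⬝ᵥ (B *ᵥ u i))) :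
    Fintype.card I ≤ B.rank := by
  classical
  have hAs : A.IsSymm := by
    have h1 := hA.1; unfold Matrix.IsHermitian at h1
    rwa [Matrix.conjTranspose_eq_transpose_of_trivial] at h1
  have hBs : B.IsSymm := by
    have h1 := hB.1; unfold Matrix.IsHermitian at h1
    rwa [Matrix.conjTranspose_eq_transpose_of_trivial] at h1
  -- scales
  set s : I → ℝ := fun i => τ i ^ e with hsdef
  have hs : ∀ i, 0 < s i := fun i => pow_pos (hτ i) e
  have hsinj : ∀ i k, i ≠ k → s i ≠ s k := by
    intro i k hik hcon
    apply hik; apply hinj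
    exact (pow_left_inj₀ (hτ i).le (hτ k).le (Nat.pos_iff_ne_zero.mp he)).mp hcon
  -- the PSD summand `P = D⁻¹ (Gram_A ⊙ Cauchy) D⁻¹`
  set C : Matrix I I ℝ := Matrix.of fun i k : I => 1 / (s i + s k) with hCdef
  have hC : C.PosSemidef := posSemidef_cauchy s hs
  have hGA : ((Matrix.of fun i' k' => u i' ⬝ᵥ (A *ᵥ u k'))).PosSemidef := posSemidef_gram hA u
  have hH : ((Matrix.of fun i' k' => u i' ⬝ᵥ (A *ᵥ u k')) ⊙ C).PosSemidef := hGA.hadamard hC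
  set Dinv : Matrix I I ℝ := Matrix.diagonal fun i => (s i)⁻¹ with hDdef
  have hP : (Dinvᴴ * ((Matrix.of fun i' k' => u i' ⬝ᵥ (A *ᵥ u k')) ⊙ C) * Dinv).PosSemidef := hH.conjTranspose_mul_mul_same Dinv
  have hDt : Dinvᴴ = Dinv := by
    rw [Matrix.conjTranspose_eq_transpose_of_trivial, hDdef, Matrix.diagonal_transpose]
  rw [hDt] at hP
  -- entries of `P`
  have hPapply : ∀ i k, (Dinv * ((Matrix.of fun i' k' => u i' ⬝ᵥ (A *ᵥ u k')) ⊙ C) * Dinv) i k = (s i)⁻¹ * ((Matrix.of fun i' k' => u i' ⬝ᵥ (A *ᵥ u k')) i k * (1 / (s i + s k))) * (s k)⁻¹ := by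
    intro i k
    simp only [hDdef, Matrix.mul_diagonal, Matrix.diagonal_mul, Matrix.hadamard_apply, hCdef, Matrix.of_apply]
  -- the decomposition `Gram_B = P + Δ`
  set Δ : I → ℝ := fun i => (Matrix.of fun i' k' => u i' ⬝ᵥ (B *ᵥ u k')) i i - (s i)⁻¹ * ((Matrix.of fun i' k' => u i' ⬝ᵥ (A *ᵥ u k')) i i * (1 / (s i + s i))) * (s i)⁻¹ with hΔdef
  have hΔpos : ∀ i, 0 < Δ i := by
    intro i
    have ht := htype i
    have hsi := hs i
    simp only [hΔdef, Matrix.of_apply]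
    have hsi3 : 0 < (s i) ^ 3 := pow_pos hsi 3
    rw [show (s i)⁻¹ * (u i ⬝ᵥ (A *ᵥ u i) * (1 / (s i + s i))) * (s i)⁻¹
        = u i ⬝ᵥ (A *ᵥ u i) / (2 * (s i) ^ 3) by field_simp; ring]
    rw [sub_pos, div_lt_iff₀ (by positivity)]
    have : (τ i ^ e) ^ 3 = s i ^ 3 := rfl
    rw [this] at ht
    linarith
  have hdecomp : (Matrix.of fun i' k' => u i' ⬝ᵥ (B *ᵥ u k')) = Dinv * ((Matrix.of fun i' k' => u i' ⬝ᵥ (A *ᵥ u k')) ⊙ C) * Dinv + Matrix.diagonal Δ := by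
    ext i k
    rw [Matrix.add_apply, hPapply]
    by_cases hik : i = k
    · subst hik
      rw [Matrix.diagonal_apply_eq]
      simp only [hΔdef]
      ring
    · rw [Matrix.diagonal_apply_ne _ hik, add_zero]
      rw [gramA_eq A J B e τ u hAs hJ hBs hker (hsinj i k hik)]
      have h1 : s i + s k ≠ 0 := ne_of_gt (add_pos (hs i) (hs k))
      have h2 : s i ≠ 0 := ne_of_gt (hs i)
      have h3 : s k ≠ 0 := ne_of_gt (hs k)
      have e1 : τ i ^ e = s i := rfl
      have e2 : τ k ^ e = s k := rfl
      rw [e1, e2]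
      field_simp
  -- `Gram_B` is positive definite
  have hGBdef : ((Matrix.of fun i' k' => u i' ⬝ᵥ (B *ᵥ u k'))).PosDef := by
    rw [Matrix.posDef_iff_dotProduct_mulVec]
    refine ⟨?_, fun x hx => ?_⟩
    · exact (posSemidef_gram hB u).1
    rw [hdecomp, Matrix.add_mulVec, dotProduct_add]
    have h1 : 0 ≤ star x ⬝ᵥ ((Dinv * ((Matrix.of fun i' k' => u i' ⬝ᵥ (A *ᵥ u k')) ⊙ C) * Dinv) *ᵥ x) :=
      (Matrix.posSemidef_iff_dotProduct_mulVec.mp hP).2 x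
    have h2 : 0 < star x ⬝ᵥ (Matrix.diagonal Δ *ᵥ x) := by
      rw [star_trivial]
      simp only [dotProduct, Matrix.mulVec_diagonal]
      obtain ⟨i₀, hi₀⟩ := Function.ne_iff.mp hx
      apply Finset.sum_pos'
      · intro i _
        have := hΔpos i
        nlinarith [sq_nonneg (x i)]
      · refine ⟨i₀, Finset.mem_univ _, ?_⟩
        have := hΔpos i₀
        have hx0 : 0 < x i₀ ^ 2 := sq_pos_iff.mpr hi₀
        nlinarith
    linarith
  -- rank count
  have hunit : IsUnit ((Matrix.of fun i' k' => u i' ⬝ᵥ (B *ᵥ u k'))) := hGBdef.isUnit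
  have hrank : ((Matrix.of fun i' k' => u i' ⬝ᵥ (B *ᵥ u k'))).rank = Fintype.card I := Matrix.rank_of_isUnit _ hunit
  rw [← hrank]
  exact rank_gram_le B u

/-- … and `rank B ≤ m`. [folklore] -/
theorem card_posType_le (A J B : Matrix (Fin m) (Fin m) ℝ) (hA : A.PosSemidef) (hJ : J.IsSymm) (hB : B.PosSemidef)
    (e : ℕ) (τ : I → ℝ) (hτ : ∀ i, 0 < τ i) (hinj : Function.Injective τ) (he : 0 < e)
    (u : I → Fin m → ℝ) (hker : ∀ i, (A + τ i ^ e • J + (τ i ^ e) ^ 3 • B) *ᵥ u i = 0)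
    (htype : ∀ i, u i ⬝ᵥ (A *ᵥ u i) < 2 * (τ i ^ e) ^ 3 * (u i ⬝ᵥ (B *ᵥ u i))) :
    Fintype.card I ≤ m := by
  have h := card_posType_le_rank A J B hA hJ hB e τ hτ hinj he u hker htype
  exact h.trans ((Matrix.rank_le_width B).trans (by simp))

/-- the type condition is the sign of the derivative of the Rayleigh trinomial at the root:
if `a + j s + b s³ = 0` (`s = τ^e > 0`) then `a < 2 s³ b ↔ 0 < j + 3 b s²` (`= d/ds` of the trinomial). [folklore] -/
theorem type_iff_rayleigh_deriv_pos {a j b s : ℝ} (hs : 0 < s) (hroot : a + j * s + b * s ^ 3 = 0) :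
    a < 2 * s ^ 3 * b ↔ 0 < j + 3 * b * s ^ 2 := by
  have hj : j = -(a + b * s ^ 3) / s := by
    field_simp
    linarith
  rw [hj]
  rw [show -(a + b * s ^ 3) / s + 3 * b * s ^ 2 = (2 * s ^ 3 * b - a) / s by field_simp; ring]
  rw [div_pos_iff_of_pos_right hs]  -- hmm name
  constructor <;> intro h <;> linarith

end Bound

end TwoSidedThree

end Summit.ValiantsHypothesis.ValiantsHypothesis.Theorems.KPlusLogSqLaw.TowerGraft
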